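import Literature.IUT.HodgeTheaters.TemperedCoveringsByName
import Literature.AnabelianGeometry.SemiGraphs.ChartFibreInjective
import Literature.AnabelianGeometry.SemiGraphs.TemperedCompletionExistence
import Literature.AnabelianGeometry.SemiGraphs.TemperedEdgeLikeDistinctProofs
import HarnessLib

/-!
# Bridge: the canonical [IUTchI] §2 𝔾-data `TemperedGraphGroupData` of a graph of anabelioids
# satisfying [SemiAnbd] Prop. 3.6 — `Π^tp_𝔾 := π₁^temp(𝒢)`, `Π̂_𝔾 :=` its profinite completion

Mochizuki, *Inter-universal Teichmüller theory I*, kurims manuscript (May 2020), §2 pp. 44–45: "the tempered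
fundamental group `Π^tp_𝔾` of `𝔾` and the pro-`Σ̂` fundamental group `Π̂_𝔾` … the natural injection
`Π^tp_𝔾 ↪ Π̂_𝔾`" [cite: Mochizuki2012, IUTchI §2 pp.44-45] (D-0012 claim key; nothing of the series is
asserted here), over Mochizuki, *Semi-graphs of anabelioids*, Publ. RIMS **42** (2006), Prop. 3.6 p. 38
[cite: MochizukiSemiAnbd2006, Prop 3.6 p.38].

BRIDGE (abc-iut L3-t7 → L5; cf. `TemperedCurveBridge.lean` for the pattern): L5's INTERFACE DATA
`TemperedGraphGroupData` (`TemperedCoverings.lean`, abc-iut-L5-t1: `Tp`, `Hat` compact, `ι : Tp →* Hat`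
continuous injective, …) receives a NON-DEGENERATE inhabitant from a graph of anabelioids `𝒢 : ProfiniteSemiGraph`
with `h36 : 𝒢.Prop36Hypotheses`:
* `Tp := π₁^temp(𝒢)` — THE constructed tempered fundamental group `(𝒢.temperedPiChart h36).G = 𝒢.temperedPi h36`
  of Prop. 3.6 (i)(ii) (abc-iut-L3-t9, `TemperedPiChartExists.lean`);
* `Hat :=` a profinite completion of `π₁^temp(𝒢)` in universe `u` (`IsProfiniteCompletion.exists_isProfiniteCompletion_injective`,
  abc-iut-L2-d1), `ι` its completion map — INJECTIVE by the discharged Prop. 3.6 (iii)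
  `TemperedPiResiduallyFinite_holds` (abc-iut-L3-d5 / w4-d064).  (Universe note: the model `Aut Φ = π̂₁(B(𝒢))` of
  `ChartFibreProfiniteCompletion.lean` lives in `Type (u+1)`; `hat_equiv_aut` identifies `Hat` with it by the
  unique comparison isomorphism, compatibly with both maps.)
* `Σ ⊆ Σ̂` and the decomposition subgroups `Π^tp_ℍ`, `Π̂_ℍ` of a sub-semi-graph stay PARAMETERS (PSC origin /
  decomposition-group rows).

Consequence: in `prop21_of_chart_of_isProfiniteCompletion` (abc-iut-L5-t11, `TemperedCoveringsByName.lean`) the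
inputs `c := 𝒢.temperedPiChart h36`, `e := refl`, `hPC` (`ofProp36_isProfiniteCompletion`), `hGal`
(`galoisDomination_of_prop36`, `TemperedGaloisDomination.lean`) and `Λv`/`hΛv` (`exists_verticialFamily_of_prop36`:
a verticial subgroup at every vertex, [SemiAnbd] Thm. 3.7 (i)) are supplied BY NAME for this data; what remains
named is `hCV` (Thm. 3.7 (iii)) and `hA3` ([NodNon] Lem. 1.9 (ii)).  Typed ≠ discharged; nothing here bears on
[IUTchIII] Cor. 3.12.
-/

noncomputable section

namespace Literature.IUT.HodgeTheaters

open CategoryTheory CategoryTheory.PreGaloisCategory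
open Literature.AnabelianGeometry.SemiGraphs Literature.AnabelianGeometry.SemiGraphs.ProfiniteSemiGraph

universe u

namespace TemperedGraphGroupData

/-- Residual finiteness of `π₁^temp(𝒢)` ([SemiAnbd] Prop. 3.6 (iii), `TemperedPiResiduallyFinite_holds`) in
the separation form of `IsProfiniteCompletion.injective_iff`: every `g ≠ 1` lies outside some open normal
subgroup of finite index. [cite: MochizukiSemiAnbd2006, Prop 3.6(iii) p.38] -/
theorem sep_of_prop36 (𝒢 : ProfiniteSemiGraph.{u}) (h36 : 𝒢.Prop36Hypotheses) (c : TemperedPiChart 𝒢) :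
    ∀ g : c.G, g ≠ 1 → ∃ U : OpenNormalSubgroup c.G, U.toSubgroup.FiniteIndex ∧ g ∉ U.toSubgroup := by
  intro g hg
  obtain ⟨N, hN, hgN⟩ := TemperedPiResiduallyFinite_holds 𝒢 h36 c g hg
  haveI := hN
  exact ⟨N, Subgroup.finiteIndex_of_finite_quotient, hgN⟩

/-- A profinite completion of `π₁^temp(𝒢)` in universe `u` with INJECTIVE completion map
(existence: `IsProfiniteCompletion.exists_isProfiniteCompletion_injective`; injectivity: Prop. 3.6 (iii)).
[cite: MochizukiSemiAnbd2006, Prop 3.6(iii) p.38] -/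
theorem exists_completion_of_prop36 (𝒢 : ProfiniteSemiGraph.{u}) (h36 : 𝒢.Prop36Hypotheses)
    (c : TemperedPiChart 𝒢) :
    ∃ (P : ProfiniteGrp.{u}) (ι : c.G →ₜ* P), IsProfiniteCompletion ι ∧ Function.Injective ι :=
  IsProfiniteCompletion.exists_isProfiniteCompletion_injective c.G (sep_of_prop36 𝒢 h36 c)

/-- **The canonical [IUTchI] §2 𝔾-data of a graph of anabelioids satisfying [SemiAnbd] Prop. 3.6**
("`Π^tp_𝔾`, `Π̂_𝔾`, the natural injection `Π^tp_𝔾 ↪ Π̂_𝔾`", pp. 44–45): `Tp := π₁^temp(𝒢)` (the constructed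
tempered fundamental group, chart `𝒢.temperedPiChart h36`), `Hat :=` a universe-`u` profinite completion with
its injective completion map `ι`; the prime sets and the decomposition subgroups `Π^tp_ℍ ≤ Π^tp_𝔾`,
`Π̂_ℍ ≤ Π̂_𝔾` (`Π^tp_ℍ ↪ Π̂_ℍ`) are parameters. ([IUTchI] §2 pp.44-45) [claim: Mochizuki2012, status: disputed] -/
def ofProp36 (𝒢 : ProfiniteSemiGraph.{u}) (h36 : 𝒢.Prop36Hypotheses)
    (Sigma SigmaHat : Set ℕ) (hsub : Sigma ⊆ SigmaHat) (hne : Sigma.Nonempty)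
    (hprime : ∀ p ∈ SigmaHat, p.Prime)
    (TpH : Subgroup (𝒢.temperedPiChart h36).G)
    (HatH : Subgroup (exists_completion_of_prop36 𝒢 h36 (𝒢.temperedPiChart h36)).choose)
    (hle : TpH.map
      (exists_completion_of_prop36 𝒢 h36 (𝒢.temperedPiChart h36)).choose_spec.choose.toMonoidHom ≤ HatH) :
    TemperedGraphGroupData.{u} where
  Sigma := Sigma
  SigmaHat := SigmaHat
  sigma_subset := hsub
  sigma_nonempty := hne
  sigmaHat_prime := hprime
  Tp := (𝒢.temperedPiChart h36).G
  Hat := (exists_completion_of_prop36 𝒢 h36 (𝒢.temperedPiChart h36)).choose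
  ι := (exists_completion_of_prop36 𝒢 h36 (𝒢.temperedPiChart h36)).choose_spec.choose.toMonoidHom
  ι_continuous := (exists_completion_of_prop36 𝒢 h36 (𝒢.temperedPiChart h36)).choose_spec.choose.continuous
  ι_injective := (exists_completion_of_prop36 𝒢 h36 (𝒢.temperedPiChart h36)).choose_spec.choose_spec.2
  TpH := TpH
  HatH := HatH
  tpH_le := hle

section

variable (𝒢 : ProfiniteSemiGraph.{u}) (h36 : 𝒢.Prop36Hypotheses)
  (Sigma SigmaHat : Set ℕ) (hsub : Sigma ⊆ SigmaHat) (hne : Sigma.Nonempty)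
  (hprime : ∀ p ∈ SigmaHat, p.Prime)
  (TpH : Subgroup (𝒢.temperedPiChart h36).G)
  (HatH : Subgroup (exists_completion_of_prop36 𝒢 h36 (𝒢.temperedPiChart h36)).choose)
  (hle : TpH.map
    (exists_completion_of_prop36 𝒢 h36 (𝒢.temperedPiChart h36)).choose_spec.choose.toMonoidHom ≤ HatH)

/-- The group of the canonical data IS `π₁^temp(𝒢) = 𝒢.temperedPi h36` (definitional).
[cite: MochizukiSemiAnbd2006, Prop 3.6(i) p.38] -/
theorem ofProp36_Tp : (ofProp36 𝒢 h36 Sigma SigmaHat hsub hne hprime TpH HatH hle).Tp = 𝒢.temperedPi h36 :=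
  rfl

/-- **`hPC` BY NAME for the canonical data**: the completion map `ι : Π^tp_𝔾 → Π̂_𝔾` of `ofProp36`
satisfies `IsProfiniteCompletion` — the hypothesis `hPC` of `prop21_of_chart_of_isProfiniteCompletion`
(with `c := 𝒢.temperedPiChart h36`, `e := ContinuousMulEquiv.refl _`). [cite: MochizukiSemiAnbd2006, Prop 3.6(iii) p.38] -/
theorem ofProp36_isProfiniteCompletion :
    IsProfiniteCompletion
      ({ toMonoidHom := (ofProp36 𝒢 h36 Sigma SigmaHat hsub hne hprime TpH HatH hle).ι,
         continuous_toFun :=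
           (ofProp36 𝒢 h36 Sigma SigmaHat hsub hne hprime TpH HatH hle).ι_continuous } :
        (ofProp36 𝒢 h36 Sigma SigmaHat hsub hne hprime TpH HatH hle).Tp →ₜ*
          (ofProp36 𝒢 h36 Sigma SigmaHat hsub hne hprime TpH HatH hle).Hat) := by
  have h := (exists_completion_of_prop36 𝒢 h36 (𝒢.temperedPiChart h36)).choose_spec.choose_spec.1
  have heq : ({ toMonoidHom := (ofProp36 𝒢 h36 Sigma SigmaHat hsub hne hprime TpH HatH hle).ι,
                continuous_toFun :=
                  (ofProp36 𝒢 h36 Sigma SigmaHat hsub hne hprime TpH HatH hle).ι_continuous } :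
        (ofProp36 𝒢 h36 Sigma SigmaHat hsub hne hprime TpH HatH hle).Tp →ₜ*
          (ofProp36 𝒢 h36 Sigma SigmaHat hsub hne hprime TpH HatH hle).Hat) =
      (exists_completion_of_prop36 𝒢 h36 (𝒢.temperedPiChart h36)).choose_spec.choose :=
    ContinuousMonoidHom.ext fun _ => rfl
  rw [heq]
  exact h

end

/-- **`Π̂_𝔾` of the canonical data is `π̂₁(B(𝒢))`**: the universe-`u` completion `Hat` is identified with
`Aut Φ` (the chart basepoint `Φ` of `B(𝒢.toAnab)`, `ChartFibreProfiniteCompletion.lean`) by an isomorphism of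
topological groups carrying `ι` to `chartActionFin` — uniqueness of the profinite completion
(`IsProfiniteCompletion.nonempty_continuousMulEquiv`, unique by `continuousMulEquiv_unique`).
[cite: MochizukiSemiAnbd2006, Prop 3.6(iii) p.38] -/
theorem hat_equiv_aut (𝒢 : ProfiniteSemiGraph.{u}) (h36 : 𝒢.Prop36Hypotheses)
    (hfin : ∀ X : 𝒢.toAnab.BObj,
      Finite ((chartFibre (𝒢.temperedPiChart h36) (isTempered_of_isFinite_of_prop36 h36)).obj X)) :
    ∃ e : (exists_completion_of_prop36 𝒢 h36 (𝒢.temperedPiChart h36)).choose ≃ₜ*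
        Aut (chartFibreFin (𝒢.temperedPiChart h36) (isTempered_of_isFinite_of_prop36 h36) hfin),
      ∀ g, e ((exists_completion_of_prop36 𝒢 h36 (𝒢.temperedPiChart h36)).choose_spec.choose g) =
        chartActionFin (𝒢.temperedPiChart h36) (isTempered_of_isFinite_of_prop36 h36) hfin g :=
  (exists_completion_of_prop36 𝒢 h36 (𝒢.temperedPiChart h36)).choose_spec.choose_spec.1.nonempty_continuousMulEquiv
    (isProfiniteCompletion_chartActionFin_of_prop36 h36 (𝒢.temperedPiChart h36) hfin)

/-- **A verticial subgroup at every vertex** ([SemiAnbd] Thm. 3.7 (i), `exists_isVerticialHom_of` +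
`range_mem_verticialSubgroups`): under `Prop36Hypotheses`, for every chart `c` there is a family
`Λv : Vertex → Subgroup π₁^temp(𝒢)` with `Λv v ∈ verticialSubgroups c v` — the inputs `Λv`, `hΛv` of
`prop21_of_chart_of_isProfiniteCompletion` for `e := refl` (`Subgroup.map` along the identity, below).
[cite: MochizukiSemiAnbd2006, Thm 3.7(i) p.40] -/
theorem exists_verticialFamily_of_prop36 (𝒢 : ProfiniteSemiGraph.{u}) (h36 : 𝒢.Prop36Hypotheses)
    (c : TemperedPiChart 𝒢) :
    ∃ Λv : 𝒢.graph.Vertex → Subgroup c.G, ∀ v, Λv v ∈ verticialSubgroups c v := by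
  have h : ∀ v : 𝒢.graph.Vertex, ∃ φ : 𝒢.Gv v →ₜ* c.G, IsVerticialHom c v φ := fun v =>
    exists_isVerticialHom_of c v (TemperoidHomEqRes_holds (𝒢.Gv v) c.G) h36.isQuasiCoherent
      h36.isGaloisCountable
  choose φ hφ using h
  exact ⟨fun v => (φ v).toMonoidHom.range, fun v => range_mem_verticialSubgroups c (φ v) (hφ v)⟩

/-- `Subgroup.map` along (the monoid homomorphism underlying) `ContinuousMulEquiv.refl` is the identity —
the `e := refl` instance of the `hΛv` binder shape `(Λv v).map (e : D.Tp →* c.G) ∈ verticialSubgroups c v`.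
[cite: MochizukiSemiAnbd2006, Thm 3.7(i) p.40] -/
theorem map_continuousMulEquiv_refl {G : Type u} [Group G] [TopologicalSpace G] (H : Subgroup G) :
    H.map ((ContinuousMulEquiv.refl G : G ≃ₜ* G) : G →* G) = H := by
  ext x
  constructor
  · rintro ⟨y, hy, rfl⟩
    exact hy
  · intro hx
    exact ⟨x, hx, rfl⟩

/-- **`Λv`/`hΛv` BY NAME for the canonical data with `e := ContinuousMulEquiv.refl`.**
[cite: MochizukiSemiAnbd2006, Thm 3.7(i) p.40] -/
theorem exists_verticialFamily_map_refl (𝒢 : ProfiniteSemiGraph.{u}) (h36 : 𝒢.Prop36Hypotheses) :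
    ∃ Λv : 𝒢.graph.Vertex → Subgroup (𝒢.temperedPiChart h36).G,
      ∀ v, (Λv v).map ((ContinuousMulEquiv.refl (𝒢.temperedPiChart h36).G :
        (𝒢.temperedPiChart h36).G ≃ₜ* (𝒢.temperedPiChart h36).G) :
          (𝒢.temperedPiChart h36).G →* (𝒢.temperedPiChart h36).G) ∈
        verticialSubgroups (𝒢.temperedPiChart h36) v := by
  obtain ⟨Λv, hΛv⟩ := exists_verticialFamily_of_prop36 𝒢 h36 (𝒢.temperedPiChart h36)
  exact ⟨Λv, fun v => by rw [map_continuousMulEquiv_refl]; exact hΛv v⟩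

end TemperedGraphGroupData

end Literature.IUT.HodgeTheaters

end
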